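import Summits.CriticalPhenomena.CardyFormulaZ2.Theorems.CoherentMorera.Negative.KirchhoffModes

/-!
# `CoherentMorera` (route `CardyComplexCone`, stmt-CriticalPhenomena-11388): character selection is
# load-bearing — a Kirchhoff-exact, coherent, precompact corner family that is not discretely holomorphic

Negative-side support for the crux `CoherentMorera` (cdisprove unit, generation 3), part 2 of 2; the
frame (`KirchhoffAt`, `potentialField`, modes `A0 … A3`, `IsZ4Character`) is part 1,
`KirchhoffModes.lean`.

**The tightness result.** The explicit family `modelField μ s` (potential field of
`Φ(x,y) = (x + iμy)²` at mesh `δ = s³`) satisfies Kirchhoff at EVERY medial vertex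
(`kirchhoffAt_modelField`), has corner values `i^{-k} s⁴(2 a_v c_k + c_k²)` of size `≍ δ^{1/3}` with a
smooth profile (`modelField_apply`; the shape of `EdgePrecompact`), is projectively coherent with the
universal vector `uModel μ` up to the EXACT defect `s⁴·const = O(δ^{4/3}) = o(δ^{1/3})`
(`coherence_defect`; the shape of `EdgeCoherence`), where `uModel μ = ((1+iμ),(μ+i),(1+iμ),(μ+i))/2`
is a character only for `μ = ±1` (`uModel_one`, `uModel_neg_one`, `uModel_not_character`) — and yet
its spin-`1/3` site observable `A₀ = 2(1+μ)(1+i) s⁴ a_v` (`A0_modelField`) has the constant NON-ZERO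
discrete `∂̄`-derivative `2(1+μ)(1−μ)(1+i)s⁴` per site (`dbar_A0_modelField`,
`dbar_A0_modelField_eq_zero_iff`), while `A₂ = 2(1−μ)(1−i)s⁴ a_v` stays alive (`A2_modelField`) and
`A₁, A₃ = O(δ^{4/3})` (`A1_modelField`, `A3_modelField`).  Summed against a test function `φ` the
discrete `∂̄` of `A₀` is, after the summation by parts behind the staggered identity, exactly the
tested quantity of the weak-holomorphy clause at scale `δ^{5/3}`, with limit a non-zero multiple of
`∫φ` for `μ ∉ {±1}`.  Hence: **the vertex relation together with the SHAPES of the two hypotheses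
does not imply the first clause of the conclusion; any proof of `CoherentMorera` must use the input
that forces the universal class vector to be a `ℤ₄`-character — the rotation covariance of
`medialExploration` / `bondPercolation` — which is therefore load-bearing.**  (`μ = 1` is the discrete
image of the conformal case `u ∝ (1,1,1,1)`, `A₂ ≡ 0`; `μ = −1` the anti-conformal one, `A₀ ≡ 0`.)
-/

noncomputable section

open Complex
open Literature.Probability.LatticeModels

namespace Summit.CriticalPhenomena.CardyFormulaZ2.Theorems.CoherentMorera.Negative

/-! ## §E Character selection is load-bearing: an exactly Kirchhoff, coherent, precompact,
## NON-holomorphic family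

Parameters: `μ : ℂ` (anisotropy; think `μ ∈ ℝ`) and `s : ℂ` (think `s = δ^{1/3} > 0`).  The physical
position of the site `v` is `δ·v = s³ v`; the potential is `Φ(x, y) = (x + iμy)²` divided by `s²`,
so that corner values are `≍ s = δ^{1/3}` on compacts. -/

/-- The anisotropic coordinate `a(v) = v₀ + iμ v₁` (so `Φ(δv) = (s³ a v)²`). [folklore] -/
def aniso (μ : ℂ) (v : Site 2) : ℂ := (v 0 : ℂ) + I * μ * (v 1 : ℂ)

/-- The face-centre offsets of the four classes in the anisotropic coordinate:
`c_k = a(−cornerOff k) + (1 + iμ)/2`. [folklore] -/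
def cOff (μ : ℂ) : Fin 4 → ℂ
  | 0 => (1 + I * μ) / 2
  | 1 => (-1 + I * μ) / 2
  | 2 => (-1 - I * μ) / 2
  | 3 => (1 - I * μ) / 2

/-- Class-0 offset `(1 + iμ)/2`. [folklore] -/
@[simp] theorem cOff_zero (μ : ℂ) : cOff μ 0 = (1 + I * μ) / 2 := rfl
/-- Class-1 offset `(-1 + iμ)/2`. [folklore] -/
@[simp] theorem cOff_one (μ : ℂ) : cOff μ 1 = (-1 + I * μ) / 2 := rfl
/-- Class-2 offset `(-1 - iμ)/2`. [folklore] -/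
@[simp] theorem cOff_two (μ : ℂ) : cOff μ 2 = (-1 - I * μ) / 2 := rfl
/-- Class-3 offset `(1 - iμ)/2`. [folklore] -/
@[simp] theorem cOff_three (μ : ℂ) : cOff μ 3 = (1 - I * μ) / 2 := rfl

/-- `a` is additive. [folklore] -/
theorem aniso_add (μ : ℂ) (v w : Site 2) : aniso μ (v + w) = aniso μ v + aniso μ w := by
  simp only [aniso, Pi.add_apply, Int.cast_add]; ring

/-- `a` respects subtraction. [folklore] -/
theorem aniso_sub (μ : ℂ) (v w : Site 2) : aniso μ (v - w) = aniso μ v - aniso μ w := by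
  simp only [aniso, Pi.sub_apply, Int.cast_sub]; ring

/-- `a(e₀) = 1`. [folklore] -/
@[simp] theorem aniso_e0 (μ : ℂ) : aniso μ (Pi.single 0 1) = 1 := by
  simp [aniso]

/-- `a(e₁) = iμ`. [folklore] -/
@[simp] theorem aniso_e1 (μ : ℂ) : aniso μ (Pi.single 1 1) = I * μ := by
  simp [aniso]

/-- `a(cornerOff 0) = a(0) = 0`. [folklore] -/
theorem aniso_cornerOff_zero (μ : ℂ) : aniso μ (cornerOff 0) = 0 := by
  simp [aniso, cornerOff]

/-- `a(cornerOff 1) = a(e₀) = 1`. [folklore] -/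
theorem aniso_cornerOff_one (μ : ℂ) : aniso μ (cornerOff 1) = 1 := by
  simp [aniso, cornerOff]

/-- `a(cornerOff 2) = a(e₀ + e₁) = 1 + iμ`. [folklore] -/
theorem aniso_cornerOff_two (μ : ℂ) : aniso μ (cornerOff 2) = 1 + I * μ := by
  simp [aniso, cornerOff]

/-- `a(cornerOff 3) = a(e₁) = iμ`. [folklore] -/
theorem aniso_cornerOff_three (μ : ℂ) : aniso μ (cornerOff 3) = I * μ := by
  simp [aniso, cornerOff]

/-- The face centre of `faceAt v k` in the anisotropic coordinate is `a v + c_k`. [folklore] -/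
theorem aniso_faceAt (μ : ℂ) (v : Site 2) (k : Fin 4) :
    aniso μ (faceAt v k) + (1 + I * μ) / 2 = aniso μ v + cOff μ k := by
  rw [faceAt, aniso_sub]
  fin_cases k
  · simp only [Fin.zero_eta, Fin.isValue, aniso_cornerOff_zero, cOff_zero]; ring
  · simp only [Fin.mk_one, Fin.isValue, aniso_cornerOff_one, cOff_one]; ring
  · simp only [Fin.reduceFinMk, Fin.isValue, aniso_cornerOff_two, cOff_two]; ring
  · simp only [Fin.reduceFinMk, Fin.isValue, aniso_cornerOff_three, cOff_three]; ring

/-- Site potential of the model: `s⁻² Φ(s³ v) = s⁴ (a v)²`. [folklore] -/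
def modelHS (μ s : ℂ) (v : Site 2) : ℂ := s ^ 4 * aniso μ v ^ 2

/-- Face potential of the model: `Φ` at the face centre. [folklore] -/
def modelHF (μ s : ℂ) (f : Site 2) : ℂ := s ^ 4 * (aniso μ f + (1 + I * μ) / 2) ^ 2

/-- **The model corner field** (potential field of `Φ = (x + iμy)²`). [folklore] -/
def modelField (μ s : ℂ) : Site 2 → Fin 4 → ℂ := potentialField (modelHS μ s) (modelHF μ s)

/-- The model satisfies Kirchhoff (DC12 Prop. 4, `χ = +i`) at EVERY medial vertex, exactly. [folklore] -/
theorem kirchhoffAt_modelField (μ s : ℂ) (v : Site 2) (k : Fin 4) :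
    KirchhoffAt (modelField μ s) v k :=
  kirchhoffAt_potentialField _ _ v k

/-- **Closed form**: `E(v,k) = i^{-k} s⁴ (2 a_v c_k + c_k²)` — size `≍ s·|s³ a_v| = δ^{1/3}|x + iμy|`
with a smooth profile: the shape of `EdgePrecompact` (local bound `C δ^{1/3}`, same-class
equicontinuity) holds in the model. [folklore] -/
theorem modelField_apply (μ s : ℂ) (v : Site 2) (k : Fin 4) :
    modelField μ s v k = wtInv k * (s ^ 4 * (2 * aniso μ v * cOff μ k + cOff μ k ^ 2)) := by
  simp only [modelField, potentialField, modelHF, modelHS, aniso_faceAt]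
  ring

/-- The coherence vector of the model: `u_k = i^{-k} c_k`. [folklore] -/
def uModel (μ : ℂ) (k : Fin 4) : ℂ := wtInv k * cOff μ k

/-- `u₀ = (1 + iμ)/2`. [folklore] -/
theorem uModel_zero (μ : ℂ) : uModel μ 0 = (1 + I * μ) / 2 := by
  simp only [uModel, wtInv_zero, cOff_zero]; ring

/-- `u₁ = (μ + i)/2`. [folklore] -/
theorem uModel_one_eq (μ : ℂ) : uModel μ 1 = (μ + I) / 2 := by
  simp only [uModel, wtInv_one, cOff_one]; linear_combination (-μ / 2) * Complex.I_sq

/-- `u₂ = (1 + iμ)/2`. [folklore] -/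
theorem uModel_two (μ : ℂ) : uModel μ 2 = (1 + I * μ) / 2 := by
  simp only [uModel, wtInv_two, cOff_two]; ring

/-- `u₃ = (μ + i)/2`. [folklore] -/
theorem uModel_three (μ : ℂ) : uModel μ 3 = (μ + I) / 2 := by
  simp only [uModel, wtInv_three, cOff_three]; linear_combination (-μ / 2) * Complex.I_sq

/-- `uModel μ = ((1+iμ), (μ+i), (1+iμ), (μ+i))/2` is an EVEN vector (`u₀ = u₂`, `u₁ = u₃`). [folklore] -/
theorem uModel_even (μ : ℂ) : uModel μ 2 = uModel μ 0 ∧ uModel μ 3 = uModel μ 1 := by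
  rw [uModel_zero, uModel_one_eq, uModel_two, uModel_three]; exact ⟨rfl, rfl⟩

/-- **Exact projective coherence defect**: `u_{k'} E(v,k) − u_k E(v,k') = s⁴ · (constant in v)`,
i.e. `O(δ^{4/3}) = o(δ^{1/3})` uniformly: the shape of `EdgeCoherence` holds in the model with the
universal vector `uModel μ`. [folklore] -/
theorem coherence_defect (μ s : ℂ) (v : Site 2) (k k' : Fin 4) :
    uModel μ k' * modelField μ s v k - uModel μ k * modelField μ s v k' =
      s ^ 4 * (wtInv k * wtInv k' * (cOff μ k * cOff μ k' * (cOff μ k - cOff μ k'))) := by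
  simp only [modelField_apply, uModel]; ring

/-- `μ = 1` (holomorphic potential `z²`): the model vector is the TRIVIAL character direction
`(1+i)/2 · (1,1,1,1)`. [folklore] -/
theorem uModel_one : ∀ k : Fin 4, uModel 1 k = (1 + I) / 2
  | 0 => (uModel_zero 1).trans (by ring)
  | 1 => (uModel_one_eq 1).trans (by ring)
  | 2 => (uModel_two 1).trans (by ring)
  | 3 => (uModel_three 1).trans (by ring)

/-- `μ = −1` (anti-holomorphic potential `z̄²`): the model vector is the character `χ₂` direction
`(1−i)/2 · (1,−1,1,−1)`. [folklore] -/
theorem uModel_neg_one : ∀ k : Fin 4, uModel (-1) k = (1 - I) / 2 * wt k ^ 2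
  | 0 => (uModel_zero (-1)).trans (by rw [wt_zero]; ring)
  | 1 => (uModel_one_eq (-1)).trans (by
      rw [wt_one]; linear_combination (-(1 - I) / 2) * Complex.I_sq)
  | 2 => (uModel_two (-1)).trans (by rw [wt_two]; ring)
  | 3 => (uModel_three (-1)).trans (by
      rw [wt_three]; linear_combination (-(1 - I) / 2) * Complex.I_sq)

/-- **Not a character otherwise**: if `uModel μ` is a `ℤ₄`-character then `μ = 1 ∨ μ = -1`
(so for every other `μ` the model is a coherent Kirchhoff field with a NON-character class
vector). [folklore] -/
theorem uModel_not_character {μ : ℂ} (h : IsZ4Character (uModel μ)) : μ = 1 ∨ μ = -1 := by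
  obtain ⟨l, -, hu⟩ := h
  have e0 : μ + I = l * (1 + I * μ) := by
    have h0 := hu 0
    rw [show (0 : Fin 4) + 1 = 1 from rfl, uModel_one_eq, uModel_zero] at h0
    linear_combination 2 * h0
  have e1 : 1 + I * μ = l * (μ + I) := by
    have h1 := hu 1
    rw [show (1 : Fin 4) + 1 = 2 from rfl, uModel_two, uModel_one_eq] at h1
    linear_combination 2 * h1
  have hl2 : (l ^ 2 - 1) * (μ + I) = 0 := by linear_combination (-1) * e0 + (-l) * e1
  have hμI : μ + I ≠ 0 := by
    intro h0
    have h2 : (1 : ℂ) + I * μ = 0 := by rw [e1, h0, mul_zero]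
    have hμ : μ = -I := by linear_combination h0
    rw [hμ] at h2
    have h3 : (2 : ℂ) = 0 := by linear_combination h2 + Complex.I_sq
    norm_num at h3
  have hl2' : l ^ 2 = 1 := by
    rcases mul_eq_zero.1 hl2 with h | h
    · linear_combination h
    · exact absurd h hμI
  have hl : l = 1 ∨ l = -1 := by
    have hfac : (l - 1) * (l + 1) = 0 := by linear_combination hl2'
    rcases mul_eq_zero.1 hfac with h | h
    · exact Or.inl (by linear_combination h)
    · exact Or.inr (by linear_combination h)
  rcases hl with rfl | rfl
  · left
    have hfac : (μ - 1) * (1 - I) = 0 := by linear_combination e0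
    rcases mul_eq_zero.1 hfac with h | h
    · linear_combination h
    · exfalso
      have := congrArg Complex.re h
      simp at this
  · right
    have hfac : (μ + 1) * (1 + I) = 0 := by linear_combination e0
    rcases mul_eq_zero.1 hfac with h | h
    · linear_combination h
    · exfalso
      have := congrArg Complex.re h
      simp at this

/-- Mode `A₀` of the model: `2(1+μ)(1+i)·s⁴·a_v` — in physical units `2(1+μ)(1+i) δ^{1/3}(x + iμy)`,
non-degenerate for `μ ≠ −1`. [folklore] -/
theorem A0_modelField (μ s : ℂ) (v : Site 2) :
    A0 (modelField μ s) v = s ^ 4 * (2 * (1 + μ) * (1 + I) * aniso μ v) := by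
  simp only [A0, modelField_apply, wtInv_zero, wtInv_one, wtInv_two, wtInv_three, cOff_zero,
    cOff_one, cOff_two, cOff_three]
  linear_combination (-2 * aniso μ v * μ * s ^ 4) * Complex.I_sq

/-- Mode `A₂` of the model: `2(1−μ)(1−i)·s⁴·a_v` — NOT `o(δ^{1/3})` for `μ ≠ 1`: the staggered mode
is alive, so the `A₀`-pairing against `∂̄φ` does not vanish in the limit. [folklore] -/
theorem A2_modelField (μ s : ℂ) (v : Site 2) :
    A2 (modelField μ s) v = s ^ 4 * (2 * (1 - μ) * (1 - I) * aniso μ v) := by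
  simp only [A2, modelField_apply, wtInv_zero, wtInv_one, wtInv_two, wtInv_three, cOff_zero,
    cOff_one, cOff_two, cOff_three]
  linear_combination (2 * aniso μ v * μ * s ^ 4) * Complex.I_sq

/-- Mode `A₁` of the model: the constant `2iμ s⁴ = O(δ^{4/3})`, consistent with the leading-order
content `A₁ = o(δ^{1/3})` of Kirchhoff. [folklore] -/
theorem A1_modelField (μ s : ℂ) (v : Site 2) :
    A1 (modelField μ s) v = s ^ 4 * (2 * I * μ) := by
  simp only [A1, modelField_apply, wtInv_zero, wtInv_one, wtInv_two, wtInv_three, cOff_zero,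
    cOff_one, cOff_two, cOff_three]
  linear_combination (s ^ 4 * (1 - 2 * I * μ + I ^ 2 * μ ^ 2) / 2) * Complex.I_sq

/-- Mode `A₃` of the model: the constant `(1 − μ²) s⁴ = O(δ^{4/3})`. [folklore] -/
theorem A3_modelField (μ s : ℂ) (v : Site 2) :
    A3 (modelField μ s) v = s ^ 4 * (1 - μ ^ 2) := by
  simp only [A3, modelField_apply, wtInv_zero, wtInv_one, wtInv_two, wtInv_three, cOff_zero,
    cOff_one, cOff_two, cOff_three]
  linear_combination (s ^ 4 * (-1 + 2 * I * μ + μ ^ 2 * (2 - I ^ 2)) / 2) * Complex.I_sq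

/-- **Non-holomorphy, exactly**: the discrete `∂̄`-derivative
`A₀(v+e₀) − A₀(v) + i (A₀(v+e₁) − A₀(v))` of the spin-`1/3` site observable of the model is the
non-zero constant `2(1+μ)(1+i)(1−μ)·s⁴` per site (`= c·δ^{4/3}`, `δ^{-2}` sites per unit area,
normalisation `δ^{5/3}·δ^{-1}` from the summation by parts: the tested quantity of the first clause
of `Conclusion` converges to a NON-ZERO multiple of `∫φ` for `μ ∉ {1, −1}`). [folklore] -/
theorem dbar_A0_modelField (μ s : ℂ) (v : Site 2) :
    A0 (modelField μ s) (v + Pi.single 0 1) - A0 (modelField μ s) v +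
        I * (A0 (modelField μ s) (v + Pi.single 1 1) - A0 (modelField μ s) v) =
      s ^ 4 * (2 * (1 + μ) * (1 + I) * (1 - μ)) := by
  rw [A0_modelField, A0_modelField, A0_modelField, aniso_add, aniso_add, aniso_e0, aniso_e1]
  linear_combination (2 * s ^ 4 * (1 + μ) * (1 + I) * μ) * Complex.I_sq

/-- For comparison, the discrete `∂̄` of `A₀` VANISHES identically exactly when `μ = 1` or `μ = −1`
(given `s ≠ 0`): the two character cases of §D. [folklore] -/
theorem dbar_A0_modelField_eq_zero_iff {μ s : ℂ} (hs : s ≠ 0) (v : Site 2) :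
    A0 (modelField μ s) (v + Pi.single 0 1) - A0 (modelField μ s) v +
        I * (A0 (modelField μ s) (v + Pi.single 1 1) - A0 (modelField μ s) v) = 0 ↔
      μ = 1 ∨ μ = -1 := by
  rw [dbar_A0_modelField]
  have h2 : (1 : ℂ) + I ≠ 0 := by
    intro h
    have := congrArg Complex.re h
    simp at this
  have hs4 : s ^ 4 ≠ 0 := pow_ne_zero 4 hs
  constructor
  · intro h
    have h' : (s ^ 4 * (2 * (1 + I))) * ((1 + μ) * (1 - μ)) = 0 := by linear_combination h
    rcases mul_eq_zero.1 h' with h'' | h''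
    · exfalso
      rcases mul_eq_zero.1 h'' with h3 | h3
      · exact hs4 h3
      · exact h2 (by linear_combination h3 / 2)
    · rcases mul_eq_zero.1 h'' with h3 | h3
      · exact Or.inr (by linear_combination h3)
      · exact Or.inl (by linear_combination -h3)
  · rintro (rfl | rfl) <;> ring

end Summit.CriticalPhenomena.CardyFormulaZ2.Theorems.CoherentMorera.Negative

end
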